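import Literature.Analysis.FluidPDE.EnstrophyGronwall
import Literature.Analysis.FluidPDE.SerrinEnstrophyGronwall
import Literature.Analysis.FluidPDE.LambFormCurlKernel
import Literature.Analysis.FluidPDE.TaoLocalisationProofs
import Mathlib.MeasureTheory.Integral.MeanInequalities

/-!
# Rung `X_1` of the Type-I ladder: the slab enstrophy inequality with Lamb-form production

Support file for the crux `TypeICertificateLadder.RungReynoldsOne`
(stmt-NavierStokesRegularity-2882), line `lp-vorticity-young-budget`, stub S4. For a classical
solution `(u, p)` of the unforced Navier–Stokes system with viscosity `ν > 0` on a closed slab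
`[0, T] × ℝ³` in Tao's class (all `L²` Sobolev norms of `u`, `∂ₜu`, `p` bounded; Tao 2013,
Thm. 5.4) and `0 < s ≤ T`:
`∫ |∇u(s)|² ≤ ∫ |∇u(0)|² + (2ν)⁻¹ ∫₀ˢ ‖u(t)‖²_{L^{10}} ‖curl u(t)‖²_{L^{5/2}} dt` (in `ℝ≥0∞`).
This is the multiplier computation of Lemarié-Rieusset 2016, Thm. 11.2 / (11.9) with multiplier
`∂ₜu` (tree templates `integral_sum_inner_fderiv_le_of_momentum`,
`lintegral_frobeniusNormSq_fderiv_le_mul_exp`), the convective term being put in Lamb form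
`(u·∇)u = curl u × u + ∇(|u|²/2)` (Majda–Bertozzi 2002, §2.1; tree
`convect_self_eq_cross_curl_add_gradient`): with `W = ∂ₜu`, `v = u(t)`, `ω = curl v`,
`∫ Σᵢ ⟪∂ᵢv, ∂ᵢW⟫ = -∫ ⟪Δv, W⟫ = -ν⁻¹ ∫ (|W|² + ⟪ω × v, W⟫ + ⟪∇(|v|²/2), W⟫ + ⟪∇p, W⟫)`, both
gradient pairings vanish against the divergence-free `W`, and pointwise
`-(|W|² + ⟪ω × v, W⟫) ≤ |v|²|ω|²/4` (`integral_sum_inner_fderiv_le_lamb`); on the slab this is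
integrated in time through `IsSmoothSpaceTimeOn.enstrophy_balance` and closed by Hölder with
exponents `5, 5/4` (`stub_enstrophyLambSlab`).

References: P. G. Lemarié-Rieusset, *The Navier–Stokes Problem in the 21st Century* (2016),
Thm. 11.2 with (11.9); A. Majda, A. Bertozzi, *Vorticity and Incompressible Flow* (2002), §2.1;
T. Tao, Anal. PDE 6 (2013), Thm. 5.4.
-/

noncomputable section

open Set Filter Topology MeasureTheory
open scoped RealInnerProductSpace ENNReal NNReal Laplacian ContDiff
open Literature.Analysis.FluidPDE

namespace Summit.NavierStokesRegularity.NavierStokesRegularity.Theorems.RungReynoldsOne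

-- the summit namespace `Summit.NavierStokesRegularity.NavierStokesRegularity.…` repeats a component
-- by design (registered stub name); the `dupNamespace` linter fires on every declaration otherwise
set_option linter.dupNamespace false

/-- `∫ (c ‖f‖)² < ∞` from `∫ ‖f‖² < ∞`. [folklore] -/
theorem lintegral_enorm_sq_const_mul_norm_lt_top {G : Type*} [NormedAddCommGroup G]
    {f : EuclideanSpace ℝ (Fin 3) → G} (c : ℝ) (hf : ∫⁻ x, ‖f x‖ₑ ^ 2 < ⊤) :
    ∫⁻ x, ‖c * ‖f x‖‖ₑ ^ 2 < ⊤ := by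
  have h : ∀ x, ‖c * ‖f x‖‖ₑ ^ 2 = ‖c‖ₑ ^ 2 * ‖f x‖ₑ ^ 2 := fun x => by
    rw [enorm_mul, enorm_norm, mul_pow]
  simp_rw [h]
  rw [lintegral_const_mul' _ _ (ENNReal.pow_ne_top enorm_ne_top)]
  exact ENNReal.mul_lt_top (ENNReal.pow_lt_top enorm_lt_top) hf

/-- **Hölder with exponents `5` and `5/4`**: `∫ |f|²|g|² ≤ (∫|f|^{10})^{1/5} (∫|g|^{5/2})^{4/5}` for
continuous fields on `ℝ³`. [folklore] -/
theorem lintegral_enorm_sq_mul_enorm_sq_le {F G : Type*} [NormedAddCommGroup F]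
    [NormedAddCommGroup G] {f : EuclideanSpace ℝ (Fin 3) → F} {g : EuclideanSpace ℝ (Fin 3) → G}
    (hf : Continuous f) (hg : Continuous g) :
    ∫⁻ x, ‖f x‖ₑ ^ 2 * ‖g x‖ₑ ^ 2 ≤
      (∫⁻ x, ‖f x‖ₑ ^ (10 : ℝ)) ^ (1 / 5 : ℝ) * (∫⁻ x, ‖g x‖ₑ ^ (5 / 2 : ℝ)) ^ (4 / 5 : ℝ) := by
  have hpq : (5 : ℝ).HolderConjugate (5 / 4) :=
    Real.holderConjugate_iff.2 ⟨by norm_num, by norm_num⟩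
  have h := ENNReal.lintegral_mul_le_Lp_mul_Lq volume hpq (f := fun x => ‖f x‖ₑ ^ 2)
    (g := fun x => ‖g x‖ₑ ^ 2) (hf.aestronglyMeasurable.enorm.pow_const 2)
    (hg.aestronglyMeasurable.enorm.pow_const 2)
  have h1 : ∀ x, (‖f x‖ₑ ^ 2) ^ (5 : ℝ) = ‖f x‖ₑ ^ (10 : ℝ) := fun x => by
    rw [← ENNReal.rpow_two, ← ENNReal.rpow_mul]; norm_num
  have h2 : ∀ x, (‖g x‖ₑ ^ 2) ^ (5 / 4 : ℝ) = ‖g x‖ₑ ^ (5 / 2 : ℝ) := fun x => by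
    rw [← ENNReal.rpow_two, ← ENNReal.rpow_mul]; norm_num
  have h3 : (1 / (5 / 4) : ℝ) = 4 / 5 := by norm_num
  simpa only [Pi.mul_apply, h1, h2, h3] using h

/-! ### The enstrophy production at a fixed time, Lamb form -/

/-- **The enstrophy production bound at a fixed time, Lamb form** (Lemarié-Rieusset 2016, (11.9),
with the convective term written `(v·∇)v = curl v × v + ∇(|v|²/2)`, Majda–Bertozzi 2002, §2.1).
Let `v ∈ C²`, `W ∈ C¹`, `q ∈ C¹` on `ℝ³` satisfy the momentum equation `W + (v·∇)v = νΔv − ∇q`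
with `div W = 0` (so `W = ∂ₜu`, `v = u(t)`, `q = p(t)` along a classical solution), `|v| ≤ M`,
and `v, ∇v, D²v, W, DW, q, Dq ∈ L²`. Then
`∫ Σᵢ ⟪∂ᵢv, ∂ᵢW⟫ ≤ (4ν)⁻¹ ∫ |v|² |curl v|²`.
Proof:
`∫ Σᵢ ⟪∂ᵢv, ∂ᵢW⟫ = −∫ ⟪Δv, W⟫ = −ν⁻¹ ∫ (|W|² + ⟪curl v × v, W⟫ + ⟪∇(|v|²/2), W⟫ + ⟪∇q, W⟫)`;
the two gradient pairings vanish against the divergence-free `W`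
(`integral_inner_gradient_eq_zero_of_isDivFree_R3`), and pointwise
`−(|W|² + ⟪curl v × v, W⟫) ≤ |curl v × v|²/4 ≤ |v|²|curl v|²/4`. -/
theorem integral_sum_inner_fderiv_le_lamb {ν : ℝ} (hν : 0 < ν)
    {v W : EuclideanSpace ℝ (Fin 3) → EuclideanSpace ℝ (Fin 3)} {q : EuclideanSpace ℝ (Fin 3) → ℝ}
    (hv : ContDiff ℝ 2 v) (hW : ContDiff ℝ 1 W) (hq : ContDiff ℝ 1 q)
    (hmom : ∀ x, W x + convect v v x = ν • (Δ v) x - gradient q x)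
    (hdivW : VectorCalculus.IsDivFree W) {M : ℝ} (hM : ∀ x, ‖v x‖ ≤ M)
    (hv0 : ∫⁻ x, ‖v x‖ₑ ^ 2 < ⊤)
    (hv1 : ∫⁻ x, ENNReal.ofReal (frobeniusNormSq (fderiv ℝ v x)) < ⊤)
    (hv2 : ∫⁻ x, ‖iteratedFDeriv ℝ 2 v x‖ₑ ^ 2 < ⊤)
    (hW0 : ∫⁻ x, ‖W x‖ₑ ^ 2 < ⊤) (hW1 : ∫⁻ x, ‖iteratedFDeriv ℝ 1 W x‖ₑ ^ 2 < ⊤)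
    (hq0 : ∫⁻ x, ‖q x‖ₑ ^ 2 < ⊤) (hq1 : ∫⁻ x, ‖iteratedFDeriv ℝ 1 q x‖ₑ ^ 2 < ⊤) :
    ∫ x, ∑ i, ⟪fderiv ℝ v x (EuclideanSpace.basisFun (Fin 3) ℝ i),
        fderiv ℝ W x (EuclideanSpace.basisFun (Fin 3) ℝ i)⟫ ≤
      (4 * ν)⁻¹ * ∫ x, ‖v x‖ ^ 2 * ‖curl v x‖ ^ 2 := by
  set e := EuclideanSpace.basisFun (Fin 3) ℝ with he
  have he1 : ∀ i, ‖e i‖ = 1 := fun i => by simp [he]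
  have hM0 : 0 ≤ M := (norm_nonneg _).trans (hM 0)
  have hdv : Differentiable ℝ v := hv.differentiable two_ne_zero
  have hv' : ContDiff ℝ 1 v := hv.of_le one_le_two
  -- the Bernoulli head `B = |v|²/2`, with `DB(x) = ⟪v(x), Dv(x)·⟫`
  set B : EuclideanSpace ℝ (Fin 3) → ℝ := fun y => ‖v y‖ ^ 2 / 2 with hB
  have hBc : ContDiff ℝ 1 B := ((contDiff_norm_sq ℝ).comp hv').div_const 2
  have hDB : ∀ x, fderiv ℝ B x = (innerSL ℝ (v x)).comp (fderiv ℝ v x) := fun x =>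
    (hasFDerivAt_half_norm_sq (hdv x)).fderiv
  -- continuity of all the fields involved
  have cv : Continuous v := hv.continuous
  have cDv : Continuous (fderiv ℝ v) := hv.continuous_fderiv two_ne_zero
  have cdiv : ∀ i, Continuous fun x => fderiv ℝ v x (e i) := fun i => cDv.clm_apply continuous_const
  have cddv : ∀ i, Continuous fun x => fderiv ℝ (fun y => fderiv ℝ v y (e i)) x (e i) := fun i =>
    ((((hv.fderiv_right (m := 1) le_rfl).clm_apply contDiff_const).continuous_fderiv
      one_ne_zero).clm_apply continuous_const)
  have cW : Continuous W := hW.continuous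
  have cDW : Continuous (fderiv ℝ W) := hW.continuous_fderiv one_ne_zero
  have cdiW : ∀ i, Continuous fun x => fderiv ℝ W x (e i) := fun i => cDW.clm_apply continuous_const
  have cgrad : ∀ {r : EuclideanSpace ℝ (Fin 3) → ℝ}, ContDiff ℝ 1 r → Continuous (gradient r) :=
    fun hr => (InnerProductSpace.toDual ℝ (EuclideanSpace ℝ (Fin 3))).symm.continuous.comp
      (hr.continuous_fderiv one_ne_zero)
  have cgq : Continuous (gradient q) := cgrad hq
  have cgB : Continuous (gradient B) := cgrad hBc
  have ccurl : Continuous (curl v) := continuous_curl hv'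
  -- finite `L²` norms of the derived fields
  have l2Dv : ∫⁻ x, ‖fderiv ℝ v x‖ₑ ^ 2 < ⊤ := lintegral_enorm_sq_fderiv_lt_top hv1
  have l2div : ∀ i, ∫⁻ x, ‖fderiv ℝ v x (e i)‖ₑ ^ 2 < ⊤ := fun i =>
    lintegral_enorm_sq_lt_top_of_norm_le (fun x => by
      simpa [he1] using (fderiv ℝ v x).le_opNorm (e i)) l2Dv
  have l2ddv : ∀ i, ∫⁻ x, ‖fderiv ℝ (fun y => fderiv ℝ v y (e i)) x (e i)‖ₑ ^ 2 < ⊤ := fun i =>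
    lintegral_enorm_sq_lt_top_of_norm_le (fun x => norm_fderiv_fderiv_apply_basisFun_le hv x i) hv2
  have l2diW : ∀ i, ∫⁻ x, ‖fderiv ℝ W x (e i)‖ₑ ^ 2 < ⊤ := fun i =>
    lintegral_enorm_sq_lt_top_of_norm_le (fun x => norm_fderiv_apply_basisFun_le W x i) hW1
  have l2diq : ∀ i, ∫⁻ x, ‖fderiv ℝ q x (e i)‖ₑ ^ 2 < ⊤ := fun i =>
    lintegral_enorm_sq_lt_top_of_norm_le (fun x => norm_fderiv_apply_basisFun_le q x i) hq1
  have l2gq : ∫⁻ x, ‖gradient q x‖ₑ ^ 2 < ⊤ := by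
    refine lintegral_enorm_sq_lt_top_of_norm_le (fun x => ?_) hq1
    rw [gradient, LinearIsometryEquiv.norm_map, ← norm_iteratedFDeriv_fderiv,
      norm_iteratedFDeriv_zero]
  have l2MDv : ∫⁻ x, ‖M * ‖fderiv ℝ v x‖‖ₑ ^ 2 < ⊤ :=
    lintegral_enorm_sq_const_mul_norm_lt_top M l2Dv
  have hDBle : ∀ x, ‖fderiv ℝ B x‖ ≤ ‖M * ‖fderiv ℝ v x‖‖ := fun x => by
    rw [hDB x]
    refine ((ContinuousLinearMap.opNorm_comp_le _ _).trans ?_).trans (Real.le_norm_self _)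
    rw [innerSL_apply_norm]
    exact mul_le_mul_of_nonneg_right (hM x) (norm_nonneg _)
  have l2diB : ∀ i, ∫⁻ x, ‖fderiv ℝ B x (e i)‖ₑ ^ 2 < ⊤ := fun i =>
    lintegral_enorm_sq_lt_top_of_norm_le (fun x =>
      le_trans (by simpa [he1] using (fderiv ℝ B x).le_opNorm (e i)) (hDBle x)) l2MDv
  have l2gB : ∫⁻ x, ‖gradient B x‖ₑ ^ 2 < ⊤ :=
    lintegral_enorm_sq_lt_top_of_norm_le (fun x => by
      rw [gradient, LinearIsometryEquiv.norm_map]; exact hDBle x) l2MDv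
  have l2B : ∫⁻ x, ‖B x‖ₑ ^ 2 < ⊤ := by
    refine lintegral_enorm_sq_lt_top_of_norm_le (b := fun x => M / 2 * ‖v x‖) (fun x => ?_)
      (lintegral_enorm_sq_const_mul_norm_lt_top _ hv0)
    refine le_trans ?_ (Real.le_norm_self _)
    simp only [hB]
    rw [Real.norm_of_nonneg (by positivity)]
    nlinarith [hM x, norm_nonneg (v x)]
  have l2ω : ∫⁻ x, ‖curl v x‖ₑ ^ 2 < ⊤ :=
    lintegral_enorm_sq_lt_top_of_norm_le (b := fun x => ‖curlCLM‖ * ‖fderiv ℝ v x‖)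
      (fun x => (norm_curl_le v x).trans (Real.le_norm_self _))
      (lintegral_enorm_sq_const_mul_norm_lt_top _ l2Dv)
  have l2curl : ∫⁻ x, ‖M * ‖curl v x‖‖ₑ ^ 2 < ⊤ := lintegral_enorm_sq_const_mul_norm_lt_top M l2ω
  -- integrability of the products
  have i1 : ∀ i, Integrable (fun x => ⟪fderiv ℝ (fun y => fderiv ℝ v y (e i)) x (e i), W x⟫)
      volume := fun i =>
    integrable_of_norm_le_mul_of_lintegral_sq ((cddv i).inner cW).aestronglyMeasurable (cddv i) cW
      (l2ddv i) hW0 fun x => norm_inner_le_norm _ _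
  have i2 : ∀ i, Integrable (fun x => ⟪fderiv ℝ v x (e i), fderiv ℝ W x (e i)⟫) volume := fun i =>
    integrable_of_norm_le_mul_of_lintegral_sq ((cdiv i).inner (cdiW i)).aestronglyMeasurable
      (cdiv i) (cdiW i) (l2div i) (l2diW i) fun x => norm_inner_le_norm _ _
  have i3 : ∀ i, Integrable (fun x => ⟪fderiv ℝ v x (e i), W x⟫) volume := fun i =>
    integrable_of_norm_le_mul_of_lintegral_sq ((cdiv i).inner cW).aestronglyMeasurable (cdiv i) cW
      (l2div i) hW0 fun x => norm_inner_le_norm _ _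
  have iLap : Integrable (fun x => ⟪(Δ v) x, W x⟫) volume := by
    refine (integrable_finsetSum Finset.univ fun i _ => i1 i).congr
      (Eventually.of_forall fun x => ?_)
    dsimp only
    rw [laplacian_eq_sum_fderiv_fderiv e hv x, sum_inner]
  have igW : Integrable (fun x => ⟪gradient q x, W x⟫) volume :=
    integrable_of_norm_le_mul_of_lintegral_sq (cgq.inner cW).aestronglyMeasurable cgq cW
      l2gq hW0 fun x => norm_inner_le_norm _ _
  have igB : Integrable (fun x => ⟪gradient B x, W x⟫) volume :=
    integrable_of_norm_le_mul_of_lintegral_sq (cgB.inner cW).aestronglyMeasurable cgB cW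
      l2gB hW0 fun x => norm_inner_le_norm _ _
  have ivo : Integrable (fun x => ‖v x‖ ^ 2 * ‖curl v x‖ ^ 2) volume := by
    refine integrable_of_norm_le_mul_of_lintegral_sq (a := fun x => M * ‖curl v x‖)
      (b := fun x => M * ‖curl v x‖) ((cv.norm.pow 2).mul (ccurl.norm.pow 2)).aestronglyMeasurable
      (continuous_const.mul ccurl.norm) (continuous_const.mul ccurl.norm) l2curl l2curl fun x => ?_
    rw [Real.norm_of_nonneg (by positivity), Real.norm_of_nonneg (mul_nonneg hM0 (norm_nonneg _))]
    calc ‖v x‖ ^ 2 * ‖curl v x‖ ^ 2 ≤ M ^ 2 * ‖curl v x‖ ^ 2 := by gcongr; exact hM x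
      _ = M * ‖curl v x‖ * (M * ‖curl v x‖) := by ring
  -- the two gradient pairings vanish
  have hin : ∀ i (y : EuclideanSpace ℝ (Fin 3)), ‖⟪e i, y⟫‖ ≤ ‖y‖ := fun i y =>
    (norm_inner_le_norm (𝕜 := ℝ) (e i) y).trans (by rw [he1, one_mul])
  have hpair : ∀ {r : EuclideanSpace ℝ (Fin 3) → ℝ}, ContDiff ℝ 1 r → (∫⁻ x, ‖r x‖ₑ ^ 2 < ⊤) →
      (∀ i, ∫⁻ x, ‖fderiv ℝ r x (e i)‖ₑ ^ 2 < ⊤) → ∫ x, ⟪gradient r x, W x⟫ = 0 := by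
    intro r hr l2r l2dir
    have cr : Continuous r := hr.continuous
    have cdir : ∀ i, Continuous fun x => fderiv ℝ r x (e i) := fun i =>
      (hr.continuous_fderiv one_ne_zero).clm_apply continuous_const
    refine integral_inner_gradient_eq_zero_of_isDivFree_R3 hr hW hdivW (fun i => ?_) (fun i => ?_)
      (fun i => ?_)
    · exact integrable_of_norm_le_mul_of_lintegral_sq
        ((continuous_const.inner cW).mul (cdir i)).aestronglyMeasurable cW (cdir i) hW0 (l2dir i)
        fun x => by rw [norm_mul]; exact mul_le_mul_of_nonneg_right (hin i _) (norm_nonneg _)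
    · exact integrable_of_norm_le_mul_of_lintegral_sq
        ((continuous_const.inner (cdiW i)).mul cr).aestronglyMeasurable (cdiW i) cr (l2diW i) l2r
        fun x => by rw [norm_mul]; exact mul_le_mul_of_nonneg_right (hin i _) (norm_nonneg _)
    · exact integrable_of_norm_le_mul_of_lintegral_sq
        ((continuous_const.inner cW).mul cr).aestronglyMeasurable cW cr hW0 l2r
        fun x => by rw [norm_mul]; exact mul_le_mul_of_nonneg_right (hin i _) (norm_nonneg _)
  have hpress : ∫ x, ⟪gradient q x, W x⟫ = 0 := hpair hq hq0 l2diq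
  have hpressB : ∫ x, ⟪gradient B x, W x⟫ = 0 := hpair hBc l2B l2diB
  -- pointwise: the momentum equation, the Lamb form and the absorption
  have hpt : ∀ x, -⟪(Δ v) x, W x⟫ ≤ (4 * ν)⁻¹ * (‖v x‖ ^ 2 * ‖curl v x‖ ^ 2) -
      ν⁻¹ * ⟪gradient B x, W x⟫ - ν⁻¹ * ⟪gradient q x, W x⟫ := by
    intro x
    have hΔ : (Δ v) x = ν⁻¹ • (W x + convect v v x + gradient q x) := by
      have h := hmom x
      rw [eq_sub_iff_add_eq] at h
      rw [h, smul_smul, inv_mul_cancel₀ hν.ne', one_smul]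
    have hL : convect v v x = cross (curl v x) (v x) + gradient B x :=
      convect_self_eq_cross_curl_add_gradient (hdv x)
    rw [hΔ, hL, real_inner_smul_left, inner_add_left, inner_add_left, inner_add_left,
      real_inner_self_eq_norm_sq]
    have hcr : ‖cross (curl v x) (v x)‖ ≤ ‖v x‖ * ‖curl v x‖ := by
      rw [norm_cross, mul_comm ‖v x‖]
      nlinarith [Real.sin_le_one (InnerProductGeometry.angle (curl v x) (v x)),
        mul_nonneg (norm_nonneg (curl v x)) (norm_nonneg (v x))]
    have hc : -⟪cross (curl v x) (v x), W x⟫ ≤ ‖v x‖ * ‖curl v x‖ * ‖W x‖ :=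
      (neg_le_abs _).trans ((abs_real_inner_le_norm _ _).trans (by gcongr))
    have key : -(‖W x‖ ^ 2 + ⟪cross (curl v x) (v x), W x⟫) ≤
        ‖v x‖ ^ 2 * ‖curl v x‖ ^ 2 / 4 := by
      nlinarith [sq_nonneg (‖W x‖ - ‖v x‖ * ‖curl v x‖ / 2), norm_nonneg (W x),
        mul_nonneg (norm_nonneg (v x)) (norm_nonneg (curl v x))]
    have := mul_le_mul_of_nonneg_left key (inv_pos.2 hν).le
    rw [show (4 * ν)⁻¹ = ν⁻¹ / 4 by rw [mul_inv]; ring]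
    linarith [this]
  -- integrate
  have hLap := integral_sum_inner_fderiv_fderiv_eq_neg_integral_inner_laplacian hv hW i1 i2 i3
  have ineg : Integrable (fun x => -⟪(Δ v) x, W x⟫) volume := iLap.neg
  have i12 : Integrable (fun x => (4 * ν)⁻¹ * (‖v x‖ ^ 2 * ‖curl v x‖ ^ 2) -
      ν⁻¹ * ⟪gradient B x, W x⟫) volume := (ivo.const_mul _).sub (igB.const_mul _)
  have irhs : Integrable (fun x => (4 * ν)⁻¹ * (‖v x‖ ^ 2 * ‖curl v x‖ ^ 2) -
      ν⁻¹ * ⟪gradient B x, W x⟫ - ν⁻¹ * ⟪gradient q x, W x⟫) volume := i12.sub (igW.const_mul _)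
  have hmono := integral_mono ineg irhs fun x => hpt x
  have hrhs : ∫ x, ((4 * ν)⁻¹ * (‖v x‖ ^ 2 * ‖curl v x‖ ^ 2) -
      ν⁻¹ * ⟪gradient B x, W x⟫ - ν⁻¹ * ⟪gradient q x, W x⟫) =
      (4 * ν)⁻¹ * ∫ x, ‖v x‖ ^ 2 * ‖curl v x‖ ^ 2 := by
    rw [integral_sub i12 (igW.const_mul _), integral_sub (ivo.const_mul _) (igB.const_mul _),
      integral_const_mul, integral_const_mul, integral_const_mul, hpress, hpressB, mul_zero,
      sub_zero, sub_zero]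
  have hneg : ∫ x, -⟪(Δ v) x, W x⟫ = -∫ x, ⟪(Δ v) x, W x⟫ := integral_neg _
  rw [hLap, ← hneg]
  exact hmono.trans hrhs.le

/-! ### The slab inequality -/

/-- **S4 — the slab enstrophy inequality with Lamb-form production.** In Tao's class on
`[0,T] × ℝ³`: `∫|∇u(s)|² ≤ ∫|∇u(0)|² + (2ν)⁻¹ ∫₀ˢ ‖u(t)‖²_{L^{10}} ‖curl u(t)‖²_{L^{5/2}} dt`
(`s ∈ (0,T]`, in `ℝ≥0∞`). Proof: enstrophy balance (`IsSmoothSpaceTimeOn.enstrophy_balance`);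
at interior times the Lamb-form slice bound `integral_sum_inner_fderiv_le_lamb`
(`2∫Σᵢ⟪∂ᵢu,∂ᵢ∂ₜu⟫ ≤ (2ν)⁻¹ ∫|u|²|curl u|²`, momentum equation with `div ∂ₜu = 0`,
`isDivFree_timeDerivWithin`), then Hölder `∫|u|²|ω|² ≤ (∫|u|^{10})^{1/5}(∫|ω|^{5/2})^{4/5}`
(`ENNReal.lintegral_mul_le_Lp_mul_Lq`, `p = 5`); all fields are `L^∞_t L²_x`, so every integral
is finite and the real identity passes to `ℝ≥0∞`. -/
theorem stub_enstrophyLambSlab :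
    ∀ ⦃ν T : ℝ⦄, 0 < ν → 0 < T →
    ∀ ⦃u : ℝ → EuclideanSpace ℝ (Fin 3) → EuclideanSpace ℝ (Fin 3)⦄
      ⦃p : ℝ → EuclideanSpace ℝ (Fin 3) → ℝ⦄,
      IsClassicalNSSolutionOn (Icc 0 T) ν 0 u p →
      HasBoundedSobolevNormsOn (Icc 0 T) u →
      HasBoundedSobolevNormsOn (Icc 0 T) (timeDerivWithin (Icc 0 T) u) →
      (∀ n : ℕ, ∃ C : ℝ≥0, ∀ t ∈ Icc 0 T, ∫⁻ x, ‖iteratedFDeriv ℝ n (p t) x‖ₑ ^ 2 ≤ C) →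
    ∀ ⦃s : ℝ⦄, s ∈ Ioc 0 T →
      ∫⁻ x, ENNReal.ofReal (frobeniusNormSq (fderiv ℝ (u s) x)) ≤
        (∫⁻ x, ENNReal.ofReal (frobeniusNormSq (fderiv ℝ (u 0) x))) +
          ENNReal.ofReal ((2 * ν)⁻¹) *
            ∫⁻ t in Ioo 0 s, (∫⁻ x, ‖u t x‖ₑ ^ (10 : ℝ)) ^ (1 / 5 : ℝ) *
              (∫⁻ x, ‖curl (u t) x‖ₑ ^ (5 / 2 : ℝ)) ^ (4 / 5 : ℝ) := by
  intro ν T hν hT u p hsol hu hut hp s hs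
  set e := EuclideanSpace.basisFun (Fin 3) ℝ with he
  have hU : UniqueDiffOn ℝ (Icc 0 T) := uniqueDiffOn_Icc hT
  set W : ℝ → EuclideanSpace ℝ (Fin 3) → EuclideanSpace ℝ (Fin 3) :=
    timeDerivWithin (Icc 0 T) u with hW
  have hWsm : IsSmoothSpaceTimeOn (Icc 0 T) W := hsol.smooth_velocity.timeDerivWithin hU
  -- a pointwise bound on `u` over the slab (Sobolev), and the uniform `L²` bounds used
  obtain ⟨B₀, hB₀⟩ := linfty_bound_of_hasBoundedSobolevNormsOn_holds
    (fun t ht => (hsol.contDiff_velocity ht).of_le (by norm_cast)) hu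
  obtain ⟨C₀, hC₀⟩ := hu 0
  obtain ⟨C₁, hC₁⟩ := hu 1
  obtain ⟨D₂, hD₂⟩ := hu 2
  obtain ⟨E₀, hE₀⟩ := hut 0
  obtain ⟨E₁, hE₁⟩ := hut 1
  obtain ⟨P₀, hP₀⟩ := hp 0
  obtain ⟨P₁, hP₁⟩ := hp 1
  have hzero : ∀ {F : Type} [NormedAddCommGroup F] [NormedSpace ℝ F]
      {f : EuclideanSpace ℝ (Fin 3) → F} {C' : ℝ≥0},
      (∫⁻ x, ‖iteratedFDeriv ℝ 0 f x‖ₑ ^ 2 ≤ C') → ∫⁻ x, ‖f x‖ₑ ^ 2 < ⊤ := by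
    intro F _ _ f C' h
    refine lt_of_le_of_lt ((le_of_eq (lintegral_congr fun x => ?_)).trans h) ENNReal.coe_lt_top
    rw [← ofReal_norm, ← ofReal_norm, norm_iteratedFDeriv_zero]
  -- `ofReal (∫ f) ≤ ∫⁻ ofReal f` for every real `f` (both sides conventional if `f ∉ L¹`)
  have hofReal : ∀ {α : Type} [MeasurableSpace α] {μ : Measure α} (f : α → ℝ),
      ENNReal.ofReal (∫ x, f x ∂μ) ≤ ∫⁻ x, ENNReal.ofReal (f x) ∂μ := by
    intro α _ μ f
    by_cases hf : Integrable f μ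
    · rw [integral_eq_lintegral_pos_part_sub_lintegral_neg_part hf]
      exact (ENNReal.ofReal_le_ofReal (sub_le_self _ ENNReal.toReal_nonneg)).trans
        ENNReal.ofReal_toReal_le
    · rw [integral_undef hf, ENNReal.ofReal_zero]
      exact zero_le
  -- the enstrophy balance
  obtain ⟨-, -, hGb⟩ := hsol.smooth_velocity.enstrophy_balance hT hC₁ hE₁
  set Φ : ℝ → ℝ := fun t => ∫ x, 2 * ∑ i, ⟪fderiv ℝ (u t) x (e i), fderiv ℝ (W t) x (e i)⟫ with hΦ
  set G : ℝ → ℝ := fun t => ∫ x, frobeniusNormSq (fderiv ℝ (u t) x) with hG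
  have hfrob_lt : ∀ t ∈ Icc 0 T,
      ∫⁻ x, ENNReal.ofReal (frobeniusNormSq (fderiv ℝ (u t) x)) < ⊤ := by
    intro t ht
    calc ∫⁻ x, ENNReal.ofReal (frobeniusNormSq (fderiv ℝ (u t) x))
        ≤ ∫⁻ x, 3 * ‖iteratedFDeriv ℝ 1 (u t) x‖ₑ ^ 2 := lintegral_mono fun x => by
          rw [← ofReal_norm, norm_iteratedFDeriv_one, ofReal_norm]
          exact ofReal_frobeniusNormSq_le_three_mul_enorm_sq _
      _ = 3 * ∫⁻ x, ‖iteratedFDeriv ℝ 1 (u t) x‖ₑ ^ 2 := lintegral_const_mul' _ _ (by norm_num)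
      _ ≤ 3 * C₁ := by gcongr; exact hC₁ t ht
      _ < ⊤ := ENNReal.mul_lt_top (by norm_num) ENNReal.coe_lt_top
  have ifrob : ∀ t ∈ Icc 0 T, Integrable (fun x => frobeniusNormSq (fderiv ℝ (u t) x)) volume :=
    fun t ht => integrable_of_continuous_of_nonneg
      (continuous_frobeniusNormSq_fderiv (hsol.contDiff_velocity ht) (by simp))
      (fun x => frobeniusNormSq_nonneg _) (hfrob_lt t ht)
  have hGeq : ∀ t ∈ Icc 0 T, ENNReal.ofReal (G t) =
      ∫⁻ x, ENNReal.ofReal (frobeniusNormSq (fderiv ℝ (u t) x)) := fun t ht =>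
    ofReal_integral_eq_lintegral_ofReal (ifrob t ht)
      (Eventually.of_forall fun x => frobeniusNormSq_nonneg _)
  -- the production bound at interior times, in `ℝ≥0∞`
  have hslice : ∀ t ∈ Ioo 0 T, ENNReal.ofReal (Φ t) ≤ ENNReal.ofReal ((2 * ν)⁻¹) *
      ((∫⁻ x, ‖u t x‖ₑ ^ (10 : ℝ)) ^ (1 / 5 : ℝ) *
        (∫⁻ x, ‖curl (u t) x‖ₑ ^ (5 / 2 : ℝ)) ^ (4 / 5 : ℝ)) := by
    intro t ht
    have htI : t ∈ Icc 0 T := Ioo_subset_Icc_self ht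
    have hu2 : ContDiff ℝ 2 (u t) := (hsol.contDiff_velocity htI).of_le (by norm_cast)
    have hmom : ∀ x, W t x + convect (u t) (u t) x = ν • (Δ (u t)) x - gradient (p t) x := by
      intro x
      have h := hsol.momentum t htI x
      simpa [hW] using h
    have hsl := integral_sum_inner_fderiv_le_lamb hν hu2
      ((hWsm.contDiff_slice htI).of_le (by norm_cast))
      ((hsol.contDiff_pressure htI).of_le (by norm_cast)) hmom
      (isDivFree_timeDerivWithin hsol.smooth_velocity hsol.divFree ht) (hB₀ t htI)
      (hzero (hC₀ t htI)) (hfrob_lt t htI) ((hD₂ t htI).trans_lt ENNReal.coe_lt_top)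
      (hzero (hE₀ t htI)) ((hE₁ t htI).trans_lt ENNReal.coe_lt_top)
      (hzero (hP₀ t htI)) ((hP₁ t htI).trans_lt ENNReal.coe_lt_top)
    have h3 : Φ t ≤ (2 * ν)⁻¹ * ∫ x, ‖u t x‖ ^ 2 * ‖curl (u t) x‖ ^ 2 := by
      rw [show Φ t = 2 * ∫ x, ∑ i, ⟪fderiv ℝ (u t) x (e i), fderiv ℝ (W t) x (e i)⟫ from
        integral_const_mul _ _]
      refine (mul_le_mul_of_nonneg_left hsl zero_le_two).trans_eq ?_
      rw [← mul_assoc, show (2 : ℝ) * (4 * ν)⁻¹ = (2 * ν)⁻¹ by rw [mul_inv, mul_inv]; ring]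
    have h5 : ENNReal.ofReal (∫ x, ‖u t x‖ ^ 2 * ‖curl (u t) x‖ ^ 2) ≤
        ∫⁻ x, ‖u t x‖ₑ ^ 2 * ‖curl (u t) x‖ₑ ^ 2 := by
      refine (hofReal _).trans (le_of_eq (lintegral_congr fun x => ?_))
      rw [ENNReal.ofReal_mul (sq_nonneg _), ENNReal.ofReal_pow (norm_nonneg _),
        ENNReal.ofReal_pow (norm_nonneg _), ofReal_norm, ofReal_norm]
    calc ENNReal.ofReal (Φ t)
        ≤ ENNReal.ofReal ((2 * ν)⁻¹ * ∫ x, ‖u t x‖ ^ 2 * ‖curl (u t) x‖ ^ 2) :=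
          ENNReal.ofReal_le_ofReal h3
      _ = ENNReal.ofReal ((2 * ν)⁻¹) * ENNReal.ofReal (∫ x, ‖u t x‖ ^ 2 * ‖curl (u t) x‖ ^ 2) :=
          ENNReal.ofReal_mul (by positivity)
      _ ≤ ENNReal.ofReal ((2 * ν)⁻¹) * ∫⁻ x, ‖u t x‖ₑ ^ 2 * ‖curl (u t) x‖ₑ ^ 2 := by gcongr
      _ ≤ _ := by
          gcongr
          exact lintegral_enorm_sq_mul_enorm_sq_le hu2.continuous
            (continuous_curl (hu2.of_le one_le_two))
  -- integrate the balance
  rw [← hGeq s ⟨hs.1.le, hs.2⟩, ← hGeq 0 ⟨le_rfl, hT.le⟩]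
  calc ENNReal.ofReal (G s) = ENNReal.ofReal (G 0 + ∫ t in (0 : ℝ)..s, Φ t) := by
        congr 1
        exact hGb s hs
    _ ≤ ENNReal.ofReal (G 0) + ENNReal.ofReal (∫ t in (0 : ℝ)..s, Φ t) := ENNReal.ofReal_add_le
    _ ≤ ENNReal.ofReal (G 0) + ∫⁻ t in Ioo 0 s, ENNReal.ofReal (Φ t) := by
        rw [intervalIntegral.integral_of_le hs.1.le, integral_Ioc_eq_integral_Ioo]
        gcongr
        exact hofReal _
    _ ≤ ENNReal.ofReal (G 0) + ∫⁻ t in Ioo 0 s, ENNReal.ofReal ((2 * ν)⁻¹) *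
          ((∫⁻ x, ‖u t x‖ₑ ^ (10 : ℝ)) ^ (1 / 5 : ℝ) *
            (∫⁻ x, ‖curl (u t) x‖ₑ ^ (5 / 2 : ℝ)) ^ (4 / 5 : ℝ)) := by
        gcongr ENNReal.ofReal (G 0) + ?_
        exact setLIntegral_mono' measurableSet_Ioo fun t ht => hslice t ⟨ht.1, ht.2.trans_le hs.2⟩
    _ = _ := by rw [lintegral_const_mul' _ _ ENNReal.ofReal_ne_top]

end Summit.NavierStokesRegularity.NavierStokesRegularity.Theorems.RungReynoldsOne

end
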